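import Summits.BirchSwinnertonDyer.BirchSwinnertonDyer.Theorems.GenusKolyvaginAtTwoGenusPrimitiveSupplyAtTwoTwistingPrimeDepthTwoInflation
import HarnessLib

/-!
# Route `GenusKolyvaginAtTwo`, K₄⁻ kernel `K4Neg` (stmt-BirchSwinnertonDyer-31526), LINE 34 «twin_bsd_road⁻» (v1.4/v1.5, T_C / F4ᵖᵍ):
# THE LEVEL-2 VALUES OF THE LAWSON–WUTHRICH CLASS — `[ξ_E, ρ]` for every `ρ ∈ Γ_{ℚ(E[2])}`, in closed form

Width seat `bsd-line-gk2-p5` g42 (cell `bsd-f1-sign2`), WIDTH-5 attach on route `GenusKolyvaginAtTwo` rev 59, lane `(NPh_K)` off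
the cut.  `--supports stmt-BirchSwinnertonDyer-31526 --as helper`.  THEOREMS ONLY (no definition, no named fact, no `sorry`); standard
axioms.  **BSD is NOT proved by this file; `K4Neg` is NOT proved; no item is closed by it.**

WHAT.  Off the cut the whole `(NPh_K)` question of LINES 33/34 is ONE `2`-adic bit of `E` — «is the Lawson–Wuthrich class
`ξ_E ∈ H¹(ℚ, E[2])` (the non-zero class dying on `Γ_{ℚ(E[4])}`, gk2-p4 g10 `GenusKolyTwistingPrime.exists_ne_zero_forall_torsionFixing_four_h1Eval_eq_zero`)
a Kummer class at `ℚ₂`?» (gk2-p4 g32/g33) — and every local computation of that bit starts from the VALUES `[ξ_E, ρ] ∈ E[2]` of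
`ξ_E` on the elements `ρ ∈ Γ_{ℚ(E[2])}` (well defined: `h1Eval` on `torsionFixing W 2`).  The pen's LINE 34 card v1.4 §(1) uses the
criterion «`res_D φ′ = 0 ⟺ D ∩ N ⊂ ±(1 + 2U)`, `U = 𝔽₂[ω]`» BY HAND.  This file makes the values a KERNEL THEOREM, in closed form:

* §1 (finite, `decide` on `2 × 2` matrices over `𝔽₂`) the explicit additive `GL₂(𝔽₂)`-equivariant map
  `Φ : M₂(𝔽₂) → 𝔽₂²`, `Φ(M) = (M₀₀ + M₀₁ + M₁₁, M₀₀ + M₁₀ + M₁₁)`: equivariance, `Φ(E₁₁) = (1,1) ≠ 0`, its zero set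
  `{0, 1, (0 1; 1 1), (1 1; 1 0)} = 𝔽₂[ω]` (the matrices `M` with `M = 0 ∨ M = 1 ∨ M² + M + 1 = 0`), and the LINE LAW
  «for `M v ∈ {0, v}` (`v ≠ 0`): `Φ(M) ∈ {0, v} ⟺ tr M = 0`».
* §2 ★ `apply_frame_h1Eval_eq_of_datum` — **for `W/ℚ` elliptic with `ρ̄_{W,2}` and `ρ_{W,4}` onto, every non-zero `x ∈ H¹(ℚ, E[2])` dying on
  `Γ_{ℚ(E[4])}`, EVERY frame `e : E[2] ≃ 𝔽₂²`, and every `ρ ∈ Γ_ℚ` acting on `E[4]` as `P ↦ P + A(2P)` with `A ↔ M` in the frame: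
  `e [x, ρ] = (M₀₀ + M₀₁ + M₁₁, M₀₀ + M₁₀ + M₁₁)`** (gk2-p4 g8's `twoByTwo_equivariant_unique`: the additive equivariant map
  `M ↦ e[x, σ_M]` of a dying class is non-zero, hence equals `Φ`).
* §3 frame-free corollaries: ★ `h1Eval_eq_zero_iff_of_datum` — **`[x, ρ] = 0 ⟺ A = 0 ∨ A = 1 ∨ A² + A + 1 = 0`** (the pen's
  `±(1+2U)` criterion: `1 + 2A ∈ ±(1 + 2𝔽₂[ω])`); ★ `h1Eval_mem_line_iff_of_datum_of_forall` — **the LINE LAW: if `A(E[2]) ⊆ {0, T}`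
  (`T ≠ 0`) then `[x, ρ] ∈ {0, T} ⟺ A T = 0`**, and `h1Eval_mem_line_iff_of_datum_of_apply_eq` — **if `A T = T` then
  `[x, ρ] ∈ {0, T} ⟺ A(E[2]) ⊄ {0, T}`** (together: for `A` preserving the line `ℓ = {0,T}`, `[x,ρ] ∈ ℓ ⟺ tr A = 0 ⟺ det(ρ|E[4]) = 1`).
READING (LINE 34 v1.5, census; nothing closed).  At a place `v` whose decomposition group `D_v` preserves a line `Λ ⊂ E[2]` and acts
on `E[4]` through `P ↦ P + A(2P)` on its part trivial on `E[2]` — e.g. `v = 2` of good ORDINARY reduction, `Λ` = the kernel-of-reduction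
line, inertia acting with `A(E[2]) ⊆ Λ` — the line law reads: `[ξ_E, τ] ∈ Λ ⟺ τ` fixes the `4`-torsion of the canonical line, i.e.
`χ₄(τ) = 1`; since Kummer classes at such `v` are «unramified modulo `Λ`», an inertial `τ ∈ Γ_{ℚ₂(E[2])}` with `χ₄(τ) = −1` is a
LEVEL-2 WITNESS (`ξ_E ∉ 𝓛₂`, hence `(NPh_K)` at every `2`-split frame by gk2-p4 g32's iff) — it exists iff `Δ_min ≡ 1 (mod 4)`.  That
reading is recorded in the seat's memo; this file proves the Galois-side law it rests on.  BSD is NOT proved by any of this.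

References: [LawsonWuthrich2016] §3 (Lemma 6, Thm. 1), §7.1; [GrossLMS1991] §9 Prop. 9.1; [Serre1972] §4.
-/

set_option linter.dupNamespace false -- `Summit.<P>.<Sub>` repeats `BirchSwinnertonDyer` (D-0017)
set_option autoImplicit false

noncomputable section

open scoped Classical Pointwise

namespace Summit.BirchSwinnertonDyer.BirchSwinnertonDyer.Theorems.GenusExact.Lw2PhantomExclusion.LevelTwoValues

open WeierstrassCurve Field NumberField IsDedekindDomain
open Literature.NumberTheory.GaloisRepresentations Literature.NumberTheory.EllipticCurves
open Literature.NumberTheory Matrix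
open Summit.BirchSwinnertonDyer.BirchSwinnertonDyer.Theorems.GenusKolyTwistingPrime

/-! ## §1 The explicit equivariant map `Φ(M) = (M₀₀ + M₀₁ + M₁₁, M₀₀ + M₁₀ + M₁₁)` — finite computations over `𝔽₂` -/

section Finite

/-- **`Φ` is `GL₂(𝔽₂)`-equivariant for conjugation**: `Φ(g M g') = g·Φ(M)` whenever `g g' = 1` (a `decide` over `2 × 2` matrices
over `𝔽₂`). [folklore] -/
theorem phi_conj (g g' M : Matrix (Fin 2) (Fin 2) (ZMod 2)) (hgg' : g * g' = 1) :
    (![(g * M * g') 0 0 + (g * M * g') 0 1 + (g * M * g') 1 1, (g * M * g') 0 0 + (g * M * g') 1 0 + (g * M * g') 1 1] :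
        Fin 2 → ZMod 2) = g *ᵥ ![M 0 0 + M 0 1 + M 1 1, M 0 0 + M 1 0 + M 1 1] := by
  revert g g' M
  decide

/-- **`Φ(E₁₁) = (1, 1)`** — in particular `Φ ≠ 0`. [folklore] -/
theorem phi_single : (![(Matrix.single 0 0 (1 : ZMod 2)) 0 0 + (Matrix.single 0 0 (1 : ZMod 2)) 0 1 + (Matrix.single 0 0 (1 : ZMod 2)) 1 1,
      (Matrix.single 0 0 (1 : ZMod 2)) 0 0 + (Matrix.single 0 0 (1 : ZMod 2)) 1 0 + (Matrix.single 0 0 (1 : ZMod 2)) 1 1] :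
        Fin 2 → ZMod 2) = ![1, 1] := by
  decide

/-- **The zero set of `Φ` is `𝔽₂[ω] = {0, 1, ω, ω²}`**, `ω, ω²` the two matrices with `M² + M + 1 = 0` (the elements of order `3`):
`Φ(M) = 0 ⟺ M = 0 ∨ M = 1 ∨ M² + M + 1 = 0`. [folklore] -/
theorem phi_eq_zero_iff (M : Matrix (Fin 2) (Fin 2) (ZMod 2)) :
    (![M 0 0 + M 0 1 + M 1 1, M 0 0 + M 1 0 + M 1 1] : Fin 2 → ZMod 2) = 0 ↔ (M = 0 ∨ M = 1 ∨ M * M + M + 1 = 0) := by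
  revert M
  decide

/-- **THE LINE LAW (finite form).**  If `M v ∈ {0, v}` for a non-zero `v ∈ 𝔽₂²` (the line `{0, v}` is `M`-stable), then
`Φ(M) ∈ {0, v} ⟺ tr M = 0`. [folklore] -/
theorem phi_mem_line_iff_trace (M : Matrix (Fin 2) (Fin 2) (ZMod 2)) (v : Fin 2 → ZMod 2) (hv : v ≠ 0)
    (hMv : M *ᵥ v = 0 ∨ M *ᵥ v = v) :
    ((![M 0 0 + M 0 1 + M 1 1, M 0 0 + M 1 0 + M 1 1] : Fin 2 → ZMod 2) = 0 ∨
        (![M 0 0 + M 0 1 + M 1 1, M 0 0 + M 1 0 + M 1 1] : Fin 2 → ZMod 2) = v) ↔ M 0 0 + M 1 1 = 0 := by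
  revert M v
  decide

/-- **The line law, case `M(𝔽₂²) ⊆ {0, v}`**: then `Φ(M) ∈ {0, v} ⟺ M v = 0`. [folklore] -/
theorem phi_mem_line_iff_of_range (M : Matrix (Fin 2) (Fin 2) (ZMod 2)) (v : Fin 2 → ZMod 2) (hv : v ≠ 0)
    (hM : ∀ w : Fin 2 → ZMod 2, M *ᵥ w = 0 ∨ M *ᵥ w = v) :
    ((![M 0 0 + M 0 1 + M 1 1, M 0 0 + M 1 0 + M 1 1] : Fin 2 → ZMod 2) = 0 ∨
        (![M 0 0 + M 0 1 + M 1 1, M 0 0 + M 1 0 + M 1 1] : Fin 2 → ZMod 2) = v) ↔ M *ᵥ v = 0 := by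
  revert M v
  decide

/-- **The line law, case `M v = v`**: then `Φ(M) ∈ {0, v} ⟺` some `M w ∉ {0, v}`. [folklore] -/
theorem phi_mem_line_iff_of_apply_eq (M : Matrix (Fin 2) (Fin 2) (ZMod 2)) (v : Fin 2 → ZMod 2) (hv : v ≠ 0)
    (hMv : M *ᵥ v = v) :
    ((![M 0 0 + M 0 1 + M 1 1, M 0 0 + M 1 0 + M 1 1] : Fin 2 → ZMod 2) = 0 ∨
        (![M 0 0 + M 0 1 + M 1 1, M 0 0 + M 1 0 + M 1 1] : Fin 2 → ZMod 2) = v) ↔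
      ∃ w : Fin 2 → ZMod 2, M *ᵥ w ≠ 0 ∧ M *ᵥ w ≠ v := by
  revert M v
  decide

/-- In `𝔽₂`, `x y = 1` forces `x = 1`. [folklore] -/
theorem eq_one_of_mul_eq_one_zmod_two (x y : ZMod 2) (h : x * y = 1) : x = 1 := by
  revert x y
  decide

end Finite

/-! ## §2 ★ The framed values of a dying class on `Γ_{ℚ(E[2])}` -/

section Values

variable (W : WeierstrassCurve ℚ) [W.IsElliptic]

/-- ★ **THE LEVEL-2 VALUES OF THE LAWSON–WUTHRICH CLASS.**  `W/ℚ` elliptic, `ρ̄_{W,2}` and `ρ_{W,4}` onto; `x ∈ H¹(ℚ, E[2])` NON-ZERO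
with `[x, h] = 0` for all `h ∈ Γ_{ℚ(E[4])}`; `e : E[2] ≃ 𝔽₂²` ANY additive frame; `ρ ∈ Γ_ℚ` acting on `E[4]` as `P ↦ P + A(2P)` for an
additive `A : E[2] → E[2]` whose matrix in the frame is `M` (`e(Av) = M·e(v)`).  Then
**`e [x, ρ] = (M₀₀ + M₀₁ + M₁₁, M₀₀ + M₁₀ + M₁₁)`.**
Proof: `M ↦ e[x, σ_M]` (`σ_M` a Galois realisation of the unipotent `u_M` of `E[4]`, gk2-p4 g8) is additive, `GL₂(𝔽₂)`-equivariant and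
non-zero (Gross Prop. 9.1 at `2`), hence equal to the explicit map `Φ` of §1 by `twoByTwo_equivariant_unique`
(`Hom_{GL₂(𝔽₂)}(M₂(𝔽₂), 𝔽₂²) = 𝔽₂`); and `[x, ρ] = [x, σ_M]` because `ρ σ_M⁻¹ ∈ Γ_{ℚ(E[4])}`.
[cite: LawsonWuthrich2016, §3 (Lemma 6, Thm. 1)] [cite: GrossLMS1991, §9 Prop. 9.1] -/
theorem apply_frame_h1Eval_eq_of_datum (hsurj : W.HasSurjectiveModNGaloisRep 2) (hsurj4 : W.HasSurjectiveModNGaloisRep 4)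
    {x : galH1Torsion W (2 : ℤ)} (hx0 : x ≠ 0) (hx : ∀ h ∈ torsionFixing W (4 : ℤ), h1Eval W (2 : ℤ) x h = 0)
    (e : geomTorsion W (2 : ℤ) ≃+ (Fin 2 → ZMod 2))
    {ρ : absoluteGaloisGroup ℚ} {A : geomTorsion W (2 : ℤ) →+ geomTorsion W (2 : ℤ)}
    (hρ : ∀ P : geomTorsion W (4 : ℤ), ((ρ • P : geomTorsion W (4 : ℤ)) : geomPoints W) =
      (P : geomPoints W) + (A ⟨(2 : ℤ) • (P : geomPoints W), two_zsmul_mem_geomTorsion_two W P⟩ : geomPoints W))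
    {M : Matrix (Fin 2) (Fin 2) (ZMod 2)} (hM : ∀ v : geomTorsion W (2 : ℤ), e (A v) = M *ᵥ e v) :
    e (h1Eval W (2 : ℤ) x ρ) = ![M 0 0 + M 0 1 + M 1 1, M 0 0 + M 1 0 + M 1 1] := by
  classical
  have hT : torsionFixing W (4 : ℤ) ≤ torsionFixing W (2 : ℤ) :=
    KolyvaginLowerBoundAtTwo.torsionFixing_le_of_dvd W (by norm_num)
  -- ### realisations `σ B` of the unipotents `u_B`, and the transfer of dying classes onto them
  choose σ hσ using fun B : geomTorsion W (2 : ℤ) →+ geomTorsion W (2 : ℤ) ↦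
    exists_smul_eq_add_apply_two_zsmul W hsurj4 B
  have hσT : ∀ B, σ B ∈ torsionFixing W (2 : ℤ) := fun B ↦ mem_torsionFixing_two_of_smul_eq_add W B (hσ B)
  have transfer : ∀ (B : geomTorsion W (2 : ℤ) →+ geomTorsion W (2 : ℤ)) {τ : absoluteGaloisGroup ℚ},
      (∀ P : geomTorsion W (4 : ℤ), ((τ • P : geomTorsion W (4 : ℤ)) : geomPoints W) =
        (P : geomPoints W) + (B ⟨(2 : ℤ) • (P : geomPoints W), two_zsmul_mem_geomTorsion_two W P⟩ : geomPoints W)) →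
      h1Eval W (2 : ℤ) x τ = h1Eval W (2 : ℤ) x (σ B) := by
    intro B τ hτ
    have h4 : τ * (σ B)⁻¹ ∈ torsionFixing W (4 : ℤ) :=
      mul_inv_mem_torsionFixing_four_of_smul_eq_add W B (hσ B) hτ
    have eτ : τ = (τ * (σ B)⁻¹) * σ B := by group
    rw [eτ, h1Eval_mul W _ x (hT h4), hx _ h4, zero_add]
  -- ### matrices ↦ endomorphisms of `E[2]` in the frame `e`
  let endo : Matrix (Fin 2) (Fin 2) (ZMod 2) → (geomTorsion W (2 : ℤ) →+ geomTorsion W (2 : ℤ)) := fun N ↦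
    e.symm.toAddMonoidHom.comp ((Matrix.toLin' N).toAddMonoidHom.comp e.toAddMonoidHom)
  have hendo : ∀ (N : Matrix (Fin 2) (Fin 2) (ZMod 2)) (v : geomTorsion W (2 : ℤ)),
      endo N v = e.symm (N *ᵥ e v) := fun N v ↦ by
    simp [endo, Matrix.toLin'_apply]
  have endo_add : ∀ N N' : Matrix (Fin 2) (Fin 2) (ZMod 2), endo (N + N') = endo N + endo N' := fun N N' ↦
    AddMonoidHom.ext fun v ↦ by rw [AddMonoidHom.add_apply, hendo, hendo, hendo, Matrix.add_mulVec, map_add]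
  have endo_surj : ∀ B : geomTorsion W (2 : ℤ) →+ geomTorsion W (2 : ℤ), ∃ N, endo N = B := by
    intro B
    refine ⟨LinearMap.toMatrix' ((e.toAddMonoidHom.comp (B.comp e.symm.toAddMonoidHom)).toZModLinearMap 2), ?_⟩
    refine AddMonoidHom.ext fun v ↦ ?_
    rw [hendo, ← Matrix.toLin'_apply, Matrix.toLin'_toMatrix']
    apply e.symm_apply_eq.mpr
    simp
  -- the user's `A` is `endo M`
  have hAM : A = endo M := AddMonoidHom.ext fun v ↦ by
    rw [hendo, ← hM, e.symm_apply_apply]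
  -- ### the additive map `F : M₂(𝔽₂) → 𝔽₂²`, `N ↦ e[x, σ_N]`
  have addF : ∀ N N' : Matrix (Fin 2) (Fin 2) (ZMod 2), e (h1Eval W (2 : ℤ) x (σ (endo (N + N')))) =
      e (h1Eval W (2 : ℤ) x (σ (endo N))) + e (h1Eval W (2 : ℤ) x (σ (endo N'))) := by
    intro N N'
    rw [← map_add, endo_add, ← transfer (endo N + endo N') (smul_eq_add_mul W (endo N) (endo N') (hσ _) (hσ _)),
      h1Eval_mul W _ x (hσT _)]
  let F : Matrix (Fin 2) (Fin 2) (ZMod 2) →+ (Fin 2 → ZMod 2) :=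
    AddMonoidHom.mk' (fun N ↦ e (h1Eval W (2 : ℤ) x (σ (endo N)))) addF
  have hF : ∀ N : Matrix (Fin 2) (Fin 2) (ZMod 2), F N = e (h1Eval W (2 : ℤ) x (σ (endo N))) := fun N ↦ rfl
  -- ### equivariance under `GL₂(𝔽₂)` (every automorphism of `E[2]` is Galois: `ρ̄_{W,2}` onto)
  have equiv : ∀ (g g' N : Matrix (Fin 2) (Fin 2) (ZMod 2)), g * g' = 1 → F (g * N * g') = g *ᵥ F N := by
    intro g g' N hgg'
    have hg'g : g' * g = 1 := mul_eq_one_comm.mp hgg'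
    let φ : geomTorsion W (2 : ℤ) ≃+ geomTorsion W (2 : ℤ) :=
      { toFun := fun v ↦ e.symm (g *ᵥ e v)
        invFun := fun v ↦ e.symm (g' *ᵥ e v)
        left_inv := fun v ↦ by
          show e.symm (g' *ᵥ e (e.symm (g *ᵥ e v))) = v
          rw [e.apply_symm_apply, Matrix.mulVec_mulVec, hg'g, Matrix.one_mulVec, e.symm_apply_apply]
        right_inv := fun v ↦ by
          show e.symm (g *ᵥ e (e.symm (g' *ᵥ e v))) = v
          rw [e.apply_symm_apply, Matrix.mulVec_mulVec, hgg', Matrix.one_mulVec, e.symm_apply_apply]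
        map_add' := fun v w ↦ by
          show e.symm (g *ᵥ e (v + w)) = e.symm (g *ᵥ e v) + e.symm (g *ᵥ e w)
          rw [map_add, Matrix.mulVec_add, map_add] }
    obtain ⟨τ, hτ⟩ := hsurj (Multiplicative.ofAdd φ)
    have hτv : ∀ v : geomTorsion W (2 : ℤ), τ • v = e.symm (g *ᵥ e v) := fun v ↦ by
      have h := galoisRepTorsion_apply W (2 : ℤ) τ v
      rw [hτ, toAdd_ofAdd] at h
      exact h.symm
    have hτ'v : ∀ v : geomTorsion W (2 : ℤ), τ⁻¹ • v = e.symm (g' *ᵥ e v) := fun v ↦ by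
      have h : τ • (e.symm (g' *ᵥ e v)) = v := by
        rw [hτv, e.apply_symm_apply, Matrix.mulVec_mulVec, hgg', Matrix.one_mulVec, e.symm_apply_apply]
      nth_rewrite 1 [← h]
      rw [inv_smul_smul]
    have hconj : endo (g * N * g') = (DistribSMul.toAddMonoidHom (geomTorsion W (2 : ℤ)) τ).comp
        ((endo N).comp (DistribSMul.toAddMonoidHom (geomTorsion W (2 : ℤ)) τ⁻¹)) :=
      AddMonoidHom.ext fun v ↦ by
        show endo (g * N * g') v = τ • (endo N (τ⁻¹ • v))
        rw [hendo, hτ'v, hendo, e.apply_symm_apply, hτv, e.apply_symm_apply, Matrix.mulVec_mulVec,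
          Matrix.mulVec_mulVec]
    rw [hF, hF, hconj, ← transfer _ (smul_eq_add_conj W (endo N) (hσ (endo N)) τ),
      h1Eval_conj W _ x τ (hσT _), hτv, e.apply_symm_apply]
  -- ### non-vanishing (Prop. 9.1 at `2`: a non-zero class does not die on `Γ_{ℚ(E[2])}`)
  have nonzero : F ≠ 0 := by
    intro hF0
    apply hx0
    apply h1_restriction_injective_two_rat W hsurj
    intro τ hτ
    obtain ⟨B, hB⟩ := exists_smul_eq_add_of_mem_torsionFixing_two W hτ
    obtain ⟨N, hN⟩ := endo_surj B
    have h := DFunLike.congr_fun hF0 N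
    rw [AddMonoidHom.zero_apply, hF, hN, ← transfer B hB] at h
    exact (map_eq_zero_iff e e.injective).mp h
  -- ### the explicit map `Φ`
  let Φ : Matrix (Fin 2) (Fin 2) (ZMod 2) →+ (Fin 2 → ZMod 2) :=
    AddMonoidHom.mk' (fun N ↦ ![N 0 0 + N 0 1 + N 1 1, N 0 0 + N 1 0 + N 1 1]) (fun N N' ↦ by
      ext i; fin_cases i <;> simp [Matrix.add_apply] <;> ring)
  have hΦ : ∀ N : Matrix (Fin 2) (Fin 2) (ZMod 2), Φ N = ![N 0 0 + N 0 1 + N 1 1, N 0 0 + N 1 0 + N 1 1] := fun N ↦ rfl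
  have equivΦ : ∀ (g g' N : Matrix (Fin 2) (Fin 2) (ZMod 2)), g * g' = 1 → Φ (g * N * g') = g *ᵥ Φ N :=
    fun g g' N hgg' ↦ by rw [hΦ, hΦ]; exact phi_conj g g' N hgg'
  have nonzeroΦ : Φ ≠ 0 := by
    intro h0
    have h : Φ (Matrix.single 0 0 (1 : ZMod 2)) = 0 := by rw [h0, AddMonoidHom.zero_apply]
    have h1 : (![1, 1] : Fin 2 → ZMod 2) = 0 := by rw [← phi_single]; exact h
    exact absurd (congr_fun h1 0) (by decide)
  -- ### `F = Φ` (§23 of gk2-p4 g8), evaluated at `M`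
  have hFΦ : F = Φ := twoByTwo_equivariant_unique F Φ equiv equivΦ nonzero nonzeroΦ
  have hval := DFunLike.congr_fun hFΦ M
  rw [hF, hΦ, ← hAM, ← transfer A hρ] at hval
  exact hval

end Values

/-! ## §3 Frame-free corollaries: the vanishing criterion and the LINE LAW -/

section Corollaries

variable (W : WeierstrassCurve ℚ) [W.IsElliptic]

/-- ★ **VANISHING CRITERION (the pen's `±(1 + 2U)` criterion in kernel form).**  Under the hypotheses of
`apply_frame_h1Eval_eq_of_datum` (no frame needed in the statement): `[x, ρ] = 0 ⟺ A = 0 ∨ A = 1 ∨ A² + A + 1 = 0` — the datum of `ρ`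
lies in `𝔽₂[ω] = {0, 1, ω, ω²} ⊂ End E[2]` (`ω, ω²` the two automorphisms of order `3`).  Hence for a subgroup `D ≤ Γ_ℚ`: `[x, ·]`
vanishes on `D ∩ Γ_{ℚ(E[2])}` iff every datum occurring in `D` lies in `𝔽₂[ω]` (LINE 34 card v1.4 §(1): `D ∩ N ⊂ ±(1 + 2U)`).
[cite: LawsonWuthrich2016, §3, §7.1] [cite: GrossLMS1991, §9 Prop. 9.1] -/
theorem h1Eval_eq_zero_iff_of_datum (hsurj : W.HasSurjectiveModNGaloisRep 2) (hsurj4 : W.HasSurjectiveModNGaloisRep 4)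
    {x : galH1Torsion W (2 : ℤ)} (hx0 : x ≠ 0) (hx : ∀ h ∈ torsionFixing W (4 : ℤ), h1Eval W (2 : ℤ) x h = 0)
    {ρ : absoluteGaloisGroup ℚ} {A : geomTorsion W (2 : ℤ) →+ geomTorsion W (2 : ℤ)}
    (hρ : ∀ P : geomTorsion W (4 : ℤ), ((ρ • P : geomTorsion W (4 : ℤ)) : geomPoints W) =
      (P : geomPoints W) + (A ⟨(2 : ℤ) • (P : geomPoints W), two_zsmul_mem_geomTorsion_two W P⟩ : geomPoints W)) :
    h1Eval W (2 : ℤ) x ρ = 0 ↔ (A = 0 ∨ A = AddMonoidHom.id _ ∨ A.comp A + A + AddMonoidHom.id _ = 0) := by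
  classical
  -- a frame and the matrix of `A`
  have h2T : ∀ P : geomTorsion W (2 : ℤ), 2 • P = 0 := fun P ↦ AddSubgroup.torsionBy.nsmul P
  have hcard : Nat.card (geomTorsion W (2 : ℤ)) = 2 ^ 2 := natCard_geomTorsion_two_rat W
  obtain ⟨e⟩ := KolyvaginImage.nonempty_addEquiv_of_card_eq_sq h2T hcard
  let M : Matrix (Fin 2) (Fin 2) (ZMod 2) :=
    LinearMap.toMatrix' ((e.toAddMonoidHom.comp (A.comp e.symm.toAddMonoidHom)).toZModLinearMap 2)
  have hM : ∀ v : geomTorsion W (2 : ℤ), e (A v) = M *ᵥ e v := by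
    intro v
    rw [← Matrix.toLin'_apply, Matrix.toLin'_toMatrix']
    simp
  have key := apply_frame_h1Eval_eq_of_datum W hsurj hsurj4 hx0 hx e hρ hM
  have hzero : h1Eval W (2 : ℤ) x ρ = 0 ↔ (![M 0 0 + M 0 1 + M 1 1, M 0 0 + M 1 0 + M 1 1] : Fin 2 → ZMod 2) = 0 := by
    rw [← key, map_eq_zero_iff e e.injective]
  rw [hzero, phi_eq_zero_iff]
  -- `A ↔ M` is a ring-like dictionary: `0 ↔ 0`, `1 ↔ id`, `M² + M + 1 ↔ A∘A + A + id`
  have hMv : ∀ v : Fin 2 → ZMod 2, M *ᵥ v = e (A (e.symm v)) := fun v ↦ by rw [hM, e.apply_symm_apply]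
  have inj : ∀ N N' : Matrix (Fin 2) (Fin 2) (ZMod 2), (∀ v, N *ᵥ v = N' *ᵥ v) → N = N' := fun N N' h ↦ by
    refine (Matrix.toLin'.injective (LinearMap.ext fun v ↦ ?_))
    rw [Matrix.toLin'_apply, Matrix.toLin'_apply, h]
  constructor
  · rintro (h | h | h)
    · left
      refine AddMonoidHom.ext fun v ↦ e.injective ?_
      rw [hM, h, Matrix.zero_mulVec, AddMonoidHom.zero_apply, map_zero]
    · right; left
      refine AddMonoidHom.ext fun v ↦ e.injective ?_
      rw [hM, h, Matrix.one_mulVec, AddMonoidHom.id_apply]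
    · right; right
      refine AddMonoidHom.ext fun v ↦ e.injective ?_
      have hcalc : e ((A.comp A + A + AddMonoidHom.id (geomTorsion W (2 : ℤ))) v) = (M * M + M + 1) *ᵥ e v := by
        rw [AddMonoidHom.add_apply, AddMonoidHom.add_apply, AddMonoidHom.comp_apply, AddMonoidHom.id_apply,
          map_add, map_add, hM, hM, Matrix.add_mulVec, Matrix.add_mulVec, ← Matrix.mulVec_mulVec, Matrix.one_mulVec]
      rw [hcalc, h, Matrix.zero_mulVec, AddMonoidHom.zero_apply, map_zero]
  · rintro (h | h | h)
    · left
      refine inj _ _ fun v ↦ ?_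
      rw [hMv, h, AddMonoidHom.zero_apply, map_zero, Matrix.zero_mulVec]
    · right; left
      refine inj _ _ fun v ↦ ?_
      rw [hMv, h, AddMonoidHom.id_apply, e.apply_symm_apply, Matrix.one_mulVec]
    · right; right
      refine inj _ _ fun v ↦ ?_
      have hv := DFunLike.congr_fun h (e.symm v)
      rw [AddMonoidHom.add_apply, AddMonoidHom.add_apply, AddMonoidHom.comp_apply, AddMonoidHom.id_apply,
        AddMonoidHom.zero_apply] at hv
      have hv' := congrArg e hv
      rw [map_add, map_add, hM, hM, e.apply_symm_apply, map_zero] at hv'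
      rw [Matrix.add_mulVec, Matrix.add_mulVec, ← Matrix.mulVec_mulVec, Matrix.one_mulVec, Matrix.zero_mulVec]
      exact hv'

/-- ★ **THE LINE LAW, case `A(E[2]) ⊆ ℓ`.**  Under the hypotheses of `apply_frame_h1Eval_eq_of_datum`, for a line `ℓ = {0, T}`
(`T ≠ 0`) of `E[2]` with `A(E[2]) ⊆ ℓ`: **`[x, ρ] ∈ ℓ ⟺ A T = 0`** (in an adapted frame `A = (α β; 0 0)` and `[x,ρ] ≡ α·T′ mod ℓ`,
`α = tr A`).  READING at an ordinary place `v ∣ 2` with `ℓ = Λ` the kernel-of-reduction line: inertia acts on `E[4]` through data with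
`A(E[2]) ⊆ Λ` (trivially on the étale quotient), and `A T = 0` iff the element fixes the `4`-torsion of the canonical line
(`χ₄ = 1`): so `[ξ_E, τ] ∈ Λ ⟺ χ₄(τ) = 1` for inertial `τ ∈ Γ_{ℚ₂(E[2])}`. [cite: LawsonWuthrich2016, §3, §7.1] [cite: Serre1972, §1.11] -/
theorem h1Eval_mem_line_iff_of_datum_of_forall (hsurj : W.HasSurjectiveModNGaloisRep 2)
    (hsurj4 : W.HasSurjectiveModNGaloisRep 4)
    {x : galH1Torsion W (2 : ℤ)} (hx0 : x ≠ 0) (hx : ∀ h ∈ torsionFixing W (4 : ℤ), h1Eval W (2 : ℤ) x h = 0)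
    {ρ : absoluteGaloisGroup ℚ} {A : geomTorsion W (2 : ℤ) →+ geomTorsion W (2 : ℤ)}
    (hρ : ∀ P : geomTorsion W (4 : ℤ), ((ρ • P : geomTorsion W (4 : ℤ)) : geomPoints W) =
      (P : geomPoints W) + (A ⟨(2 : ℤ) • (P : geomPoints W), two_zsmul_mem_geomTorsion_two W P⟩ : geomPoints W))
    {T : geomTorsion W (2 : ℤ)} (hT : T ≠ 0) (hA : ∀ S : geomTorsion W (2 : ℤ), A S = 0 ∨ A S = T) :
    (h1Eval W (2 : ℤ) x ρ = 0 ∨ h1Eval W (2 : ℤ) x ρ = T) ↔ A T = 0 := by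
  classical
  have h2T : ∀ P : geomTorsion W (2 : ℤ), 2 • P = 0 := fun P ↦ AddSubgroup.torsionBy.nsmul P
  have hcard : Nat.card (geomTorsion W (2 : ℤ)) = 2 ^ 2 := natCard_geomTorsion_two_rat W
  obtain ⟨e⟩ := KolyvaginImage.nonempty_addEquiv_of_card_eq_sq h2T hcard
  let M : Matrix (Fin 2) (Fin 2) (ZMod 2) :=
    LinearMap.toMatrix' ((e.toAddMonoidHom.comp (A.comp e.symm.toAddMonoidHom)).toZModLinearMap 2)
  have hM : ∀ v : geomTorsion W (2 : ℤ), e (A v) = M *ᵥ e v := by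
    intro v
    rw [← Matrix.toLin'_apply, Matrix.toLin'_toMatrix']
    simp
  have hMv : ∀ v : Fin 2 → ZMod 2, M *ᵥ v = e (A (e.symm v)) := fun v ↦ by rw [hM, e.apply_symm_apply]
  have key := apply_frame_h1Eval_eq_of_datum W hsurj hsurj4 hx0 hx e hρ hM
  have hv : e T ≠ 0 := fun h ↦ hT ((map_eq_zero_iff e e.injective).mp h)
  have hrange : ∀ w : Fin 2 → ZMod 2, M *ᵥ w = 0 ∨ M *ᵥ w = e T := by
    intro w
    rcases hA (e.symm w) with h | h
    · left; rw [hMv, h, map_zero]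
    · right; rw [hMv, h]
  have hfin := phi_mem_line_iff_of_range M (e T) hv hrange
  rw [← key, map_eq_zero_iff e e.injective, e.apply_eq_iff_eq, hMv, e.symm_apply_apply,
    map_eq_zero_iff e e.injective] at hfin
  exact hfin

/-- ★ **THE LINE LAW, case `A T = T`.**  Under the hypotheses of `apply_frame_h1Eval_eq_of_datum`, for a line `ℓ = {0, T}` (`T ≠ 0`)
with `A T = T`: **`[x, ρ] ∈ ℓ ⟺ A(E[2]) ⊄ ℓ`** (adapted frame: `A = (1 β; 0 δ)`, `[x, ρ] ≡ (1 + δ)·T′ mod ℓ`).  With the previous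
theorem: for `A` preserving `ℓ`, `[x, ρ] ∈ ℓ ⟺ tr A = 0 ⟺ det(ρ | E[4]) = det(1 + 2A) = 1`. [cite: LawsonWuthrich2016, §3, §7.1] -/
theorem h1Eval_mem_line_iff_of_datum_of_apply_eq (hsurj : W.HasSurjectiveModNGaloisRep 2)
    (hsurj4 : W.HasSurjectiveModNGaloisRep 4)
    {x : galH1Torsion W (2 : ℤ)} (hx0 : x ≠ 0) (hx : ∀ h ∈ torsionFixing W (4 : ℤ), h1Eval W (2 : ℤ) x h = 0)
    {ρ : absoluteGaloisGroup ℚ} {A : geomTorsion W (2 : ℤ) →+ geomTorsion W (2 : ℤ)}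
    (hρ : ∀ P : geomTorsion W (4 : ℤ), ((ρ • P : geomTorsion W (4 : ℤ)) : geomPoints W) =
      (P : geomPoints W) + (A ⟨(2 : ℤ) • (P : geomPoints W), two_zsmul_mem_geomTorsion_two W P⟩ : geomPoints W))
    {T : geomTorsion W (2 : ℤ)} (hT : T ≠ 0) (hAT : A T = T) :
    (h1Eval W (2 : ℤ) x ρ = 0 ∨ h1Eval W (2 : ℤ) x ρ = T) ↔ ∃ S : geomTorsion W (2 : ℤ), A S ≠ 0 ∧ A S ≠ T := by
  classical
  have h2T : ∀ P : geomTorsion W (2 : ℤ), 2 • P = 0 := fun P ↦ AddSubgroup.torsionBy.nsmul P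
  have hcard : Nat.card (geomTorsion W (2 : ℤ)) = 2 ^ 2 := natCard_geomTorsion_two_rat W
  obtain ⟨e⟩ := KolyvaginImage.nonempty_addEquiv_of_card_eq_sq h2T hcard
  let M : Matrix (Fin 2) (Fin 2) (ZMod 2) :=
    LinearMap.toMatrix' ((e.toAddMonoidHom.comp (A.comp e.symm.toAddMonoidHom)).toZModLinearMap 2)
  have hM : ∀ v : geomTorsion W (2 : ℤ), e (A v) = M *ᵥ e v := by
    intro v
    rw [← Matrix.toLin'_apply, Matrix.toLin'_toMatrix']
    simp
  have hMv : ∀ v : Fin 2 → ZMod 2, M *ᵥ v = e (A (e.symm v)) := fun v ↦ by rw [hM, e.apply_symm_apply]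
  have key := apply_frame_h1Eval_eq_of_datum W hsurj hsurj4 hx0 hx e hρ hM
  have hv : e T ≠ 0 := fun h ↦ hT ((map_eq_zero_iff e e.injective).mp h)
  have hMT : M *ᵥ e T = e T := by rw [← hM, hAT]
  have hfin := phi_mem_line_iff_of_apply_eq M (e T) hv hMT
  rw [← key, map_eq_zero_iff e e.injective, e.apply_eq_iff_eq] at hfin
  rw [hfin]
  constructor
  · rintro ⟨w, h1, h2⟩
    refine ⟨e.symm w, fun h ↦ h1 ?_, fun h ↦ h2 ?_⟩
    · rw [hMv, h, map_zero]
    · rw [hMv, h]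
  · rintro ⟨S, h1, h2⟩
    refine ⟨e S, fun h ↦ h1 ?_, fun h ↦ h2 ?_⟩
    · rw [hMv, e.symm_apply_apply, map_eq_zero_iff e e.injective] at h; exact h
    · rw [hMv, e.symm_apply_apply, e.apply_eq_iff_eq] at h; exact h

end Corollaries

end Summit.BirchSwinnertonDyer.BirchSwinnertonDyer.Theorems.GenusExact.Lw2PhantomExclusion.LevelTwoValues

end
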